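import Literature.MathematicalPhysics.QuantumLattice.WilsonFermionGramRegularity
import Literature.MathematicalPhysics.QuantumFieldTheory.ConstructiveQFTWave0OddRPProofs
import Summits.QuantumFields.QCD.Theorems.HeatSlicedQuarksInterleavedFlowProperStubFineWeightAdmissibleSymm
import HarnessLib

/-!
# Fine-weight admissibility, part 4: regularity and locality of the odd-torus Gram data
(crux stmt-QuantumFields-18031 `HeatSlicedQuarks.InterleavedFlowProper`, line `Sketch`,
stub `stub_fineWeightAdmissible`, clause (6))

Continuity (hence measurability and boundedness, the configuration space `SU(N)^{edges}` being
compact metrisable) in the gauge field of the fermionic features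
`Φ_q(V) = c(V) · Ψ_q(𝔊(V))` and of the kernel `K(V) = det a_{S+1}[V] · gramCoupling 1 𝒴_{S+1}[V]`
of the odd-torus Gram identity (part 3), and their locality with respect to the blocks of the
odd-torus link-reflection mechanism (`ConstructiveQFTWave0OddRPProofs`): `Φ_q` depends only on
the links of `WilsonOddRP.oPosEdges ∪ WilsonOddRP.lowerEdges` (base point in the slices
`0 ≤ t ≤ S`; for `t = 0` only the temporal crossing links), `K` only on the spatial links of the
shared slice `t = S + 1` (`WilsonOddRP.oSharedEdges`). The slice data are passed as functions
with their defining equations (`A = sliceDiag`, `Ys = transferStep`, `W = linkBlock ∘ sliceLink`,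
`G` = the half transfer product, `c` = the product of the positive slice determinants), as in
part 3. Adapted from the tree's even-torus file `WilsonFermionGramRegularity`. All statements are
proved; no definitions.
-/

noncomputable section

-- The time-slice index types are too deep for the default instance-search size bound
-- (`DecidableEq`, needed by `Matrix.det`), as in the tree's `WilsonFermionGramRegularity`.
set_option synthInstance.maxSize 512

namespace Summit.QuantumFields.QCD.Cruxes.InterleavedFlowProper.OffsetLastFormatHandover

namespace FineWeight

open Literature.MathematicalPhysics.QuantumFieldTheory Literature.MathematicalPhysics.QuantumLattice
open Literature.Probability.LatticeModels Literature.LinearAlgebra.Matrix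
open _root_.MeasureTheory Matrix Complex Finset
open scoped Kronecker ComplexOrder

variable {n N : ℕ}


/-! ## Locality of the slice data -/

/-- The spatial blocks `a_t, b_t` of two fields with the same spatial slice links agree. -/
theorem sliceDiag_sliceOff_congr {U V : GaugeConfig 4 (n + 1) (Matrix.specialUnitaryGroup (Fin N) ℂ)}
    {t : Fin (n + 1)} (hUV : ∀ (y : Fin 3 → ZMod (n + 1)) (j : Fin 3), U (sliceSite t y, j.succ) = V (sliceSite t y, j.succ))
    (m : ℝ) :
    sliceDiag (unitaryFundamentalRep (Fin N) ℂ) (apLift U) m t = sliceDiag (unitaryFundamentalRep (Fin N) ℂ) (apLift V) m t ∧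
      sliceOff (unitaryFundamentalRep (Fin N) ℂ) (apLift U) t = sliceOff (unitaryFundamentalRep (Fin N) ℂ) (apLift V) t := by
  -- adapted from `Literature.MathematicalPhysics.QuantumLattice.apDiag_apOff_congr` (even tori)
  have h1 : ∀ j, sliceHop (unitaryFundamentalRep (Fin N) ℂ) (apLift U) t j =
      sliceHop (unitaryFundamentalRep (Fin N) ℂ) (apLift V) t j := fun j => by
    ext p q; simp only [sliceHop, Matrix.of_apply, apLift_sliceSite_succ, unitaryLift_apply, hUV]
  have h2 : ∀ j, sliceHop' (unitaryFundamentalRep (Fin N) ℂ) (apLift U) t j =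
      sliceHop' (unitaryFundamentalRep (Fin N) ℂ) (apLift V) t j := fun j => by
    ext p q; simp only [sliceHop', Matrix.of_apply, apLift_sliceSite_succ, unitaryLift_apply, hUV]
  exact ⟨by simp only [sliceDiag, h1, h2], by simp only [sliceOff, h1, h2]⟩

/-- The temporal block `w_t` of two fields with the same temporal links of the layer `t` agree. -/
theorem sliceLink_congr {U V : GaugeConfig 4 (n + 1) (Matrix.specialUnitaryGroup (Fin N) ℂ)} {t : Fin (n + 1)}
    (hUV : ∀ y : Fin 3 → ZMod (n + 1), U (sliceSite t y, 0) = V (sliceSite t y, 0)) :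
    sliceLink (unitaryFundamentalRep (Fin N) ℂ) (unitaryLift U) t =
      sliceLink (unitaryFundamentalRep (Fin N) ℂ) (unitaryLift V) t := by
  ext ⟨⟨y, a⟩, k⟩ ⟨⟨y', b⟩, k'⟩
  simp only [sliceLink_apply, unitaryLift_apply, hUV]


/-- The time coordinate of a slice site. -/
theorem val_sliceSite_zero' (t : Fin (n + 1)) (y : Fin 3 → ZMod (n + 1)) : ((sliceSite t y) 0).val = t.val := by
  rw [sliceSite_apply_zero]
  rfl

/-! ## Continuity of the slice data on a torus of arbitrary side -/

/-- The matrix of an antiperiodically lifted link depends continuously on the gauge field. -/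
theorem continuous_coe_apLift' (e : Edge 4 (n + 1)) :
    Continuous fun U : GaugeConfig 4 (n + 1) (Matrix.specialUnitaryGroup (Fin N) ℂ) =>
      ((apLift U e : Matrix.unitaryGroup (Fin N) ℂ) : Matrix (Fin N) (Fin N) ℂ) := by
  -- adapted from `Literature.MathematicalPhysics.QuantumLattice.continuous_coe_apLift`
  simp only [coe_apLift_apply]
  split_ifs
  · exact (continuous_subtype_val.comp (continuous_apply e)).neg
  · exact continuous_subtype_val.comp (continuous_apply e)

/-- The inverse matrix of an antiperiodically lifted link depends continuously on the gauge field. -/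
theorem continuous_coe_apLift_inv' (e : Edge 4 (n + 1)) :
    Continuous fun U : GaugeConfig 4 (n + 1) (Matrix.specialUnitaryGroup (Fin N) ℂ) =>
      (((apLift U e)⁻¹ : Matrix.unitaryGroup (Fin N) ℂ) : Matrix (Fin N) (Fin N) ℂ) := by
  have : ∀ U : GaugeConfig 4 (n + 1) (Matrix.specialUnitaryGroup (Fin N) ℂ),
      (((apLift U e)⁻¹ : Matrix.unitaryGroup (Fin N) ℂ) : Matrix (Fin N) (Fin N) ℂ) =
      (((apLift U e : Matrix.unitaryGroup (Fin N) ℂ) : Matrix (Fin N) (Fin N) ℂ))ᴴ := fun U => by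
    rw [← Unitary.star_eq_inv, Unitary.coe_star, Matrix.star_eq_conjTranspose]
  simp only [this]
  exact (continuous_coe_apLift' e).matrix_conjTranspose

/-- The matrix of a link depends continuously on the gauge field. -/
theorem continuous_coe_unitaryLift' (e : Edge 4 (n + 1)) :
    Continuous fun U : GaugeConfig 4 (n + 1) (Matrix.specialUnitaryGroup (Fin N) ℂ) =>
      ((unitaryLift U e : Matrix.unitaryGroup (Fin N) ℂ) : Matrix (Fin N) (Fin N) ℂ) := by
  simp only [coe_unitaryLift_apply]
  exact continuous_subtype_val.comp (continuous_apply e)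

/-- A function which is one of two continuous functions according to a fixed condition is continuous. -/
private theorem continuous_ite_const' {X Y : Type*} [TopologicalSpace X] [TopologicalSpace Y] (p : Prop) [Decidable p]
    {f g : X → Y} (hf : Continuous f) (hg : Continuous g) : Continuous fun x => if p then f x else g x := by
  by_cases hp : p <;> simp only [hp, ↓reduceIte] <;> assumption

/-- `U ↦ a_t[U]` is continuous. -/
theorem continuous_sliceDiag_apLift (m : ℝ) (t : Fin (n + 1)) :
    Continuous fun U : GaugeConfig 4 (n + 1) (Matrix.specialUnitaryGroup (Fin N) ℂ) =>
      sliceDiag (unitaryFundamentalRep (Fin N) ℂ) (apLift U) m t := by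
  refine continuous_matrix fun p q => ?_
  obtain ⟨⟨y, a⟩, k⟩ := p
  obtain ⟨⟨y', b⟩, k'⟩ := q
  simp only [sliceDiag_apply, unitaryFundamentalRep_apply]
  refine continuous_const.sub (continuous_const.mul (continuous_finsetSum _ fun j _ => ?_))
  exact ((continuous_ite_const' _ (((continuous_coe_apLift' _).matrix_elem a b)) continuous_const).add
    (continuous_ite_const' _ (((continuous_coe_apLift_inv' _).matrix_elem a b)) continuous_const)).mul continuous_const

/-- `U ↦ b_t[U]` is continuous. -/
theorem continuous_sliceOff_apLift (t : Fin (n + 1)) :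
    Continuous fun U : GaugeConfig 4 (n + 1) (Matrix.specialUnitaryGroup (Fin N) ℂ) =>
      sliceOff (unitaryFundamentalRep (Fin N) ℂ) (apLift U) t := by
  refine continuous_matrix fun p q => ?_
  obtain ⟨⟨y, a⟩, k⟩ := p
  obtain ⟨⟨y', b⟩, k'⟩ := q
  simp only [sliceOff_apply, unitaryFundamentalRep_apply]
  refine continuous_const.mul (continuous_finsetSum _ fun j _ => ?_)
  exact ((continuous_ite_const' _ (((continuous_coe_apLift' _).matrix_elem a b)) continuous_const).sub
    (continuous_ite_const' _ (((continuous_coe_apLift_inv' _).matrix_elem a b)) continuous_const)).mul continuous_const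

/-- `U ↦ w_t[U]` is continuous. -/
theorem continuous_sliceLink_unitaryLift (t : Fin (n + 1)) :
    Continuous fun U : GaugeConfig 4 (n + 1) (Matrix.specialUnitaryGroup (Fin N) ℂ) =>
      sliceLink (unitaryFundamentalRep (Fin N) ℂ) (unitaryLift U) t := by
  refine continuous_matrix fun p q => ?_
  obtain ⟨⟨y, a⟩, k⟩ := p
  obtain ⟨⟨y', b⟩, k'⟩ := q
  simp only [sliceLink_apply, unitaryFundamentalRep_apply]
  exact (continuous_ite_const' _ ((continuous_coe_unitaryLift' _).matrix_elem a b) continuous_const).mul continuous_const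

variable [NeZero N]

/-- `U ↦ a_t[U]⁻¹` is continuous (`m > -1`). -/
theorem continuous_sliceDiag_apLift_inv {m : ℝ} (hm : -1 < m) (t : Fin (n + 1)) :
    Continuous fun U : GaugeConfig 4 (n + 1) (Matrix.specialUnitaryGroup (Fin N) ℂ) =>
      (sliceDiag (unitaryFundamentalRep (Fin N) ℂ) (apLift U) m t)⁻¹ := by
  have heq : ∀ U : GaugeConfig 4 (n + 1) (Matrix.specialUnitaryGroup (Fin N) ℂ),
      (sliceDiag (unitaryFundamentalRep (Fin N) ℂ) (apLift U) m t)⁻¹ =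
      ((sliceDiag (unitaryFundamentalRep (Fin N) ℂ) (apLift U) m t).det)⁻¹ •
        (sliceDiag (unitaryFundamentalRep (Fin N) ℂ) (apLift U) m t).adjugate := fun U => by
    rw [Matrix.inv_def, Ring.inverse_eq_inv']
  simp only [heq]
  exact ((continuous_sliceDiag_apLift m t).matrix_det.inv₀ fun U =>
    (posDef_sliceDiag _ unitaryFundamentalRep_mem_unitaryGroup _ hm t).det_pos.ne').smul
    (continuous_sliceDiag_apLift m t).matrix_adjugate

/-- `U ↦ 𝒴_t[U]` is continuous (`m > -1`). -/
theorem continuous_transferStep_slice {m : ℝ} (hm : -1 < m) (t : Fin (n + 1)) :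
    Continuous fun U : GaugeConfig 4 (n + 1) (Matrix.specialUnitaryGroup (Fin N) ℂ) =>
      transferStep (sliceDiag (unitaryFundamentalRep (Fin N) ℂ) (apLift U) m t)
        (sliceOff (unitaryFundamentalRep (Fin N) ℂ) (apLift U) t)
        (sliceDiag (unitaryFundamentalRep (Fin N) ℂ) (apLift U) m t) := by
  unfold transferStep
  have ha := continuous_sliceDiag_apLift (N := N) (n := n) m t
  have hai := continuous_sliceDiag_apLift_inv (N := N) (n := n) hm t
  have hb := continuous_sliceOff_apLift (N := N) (n := n) t
  exact Continuous.matrix_fromBlocks hai (hai.matrix_mul hb).neg (hb.matrix_conjTranspose.matrix_mul hai).neg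
    (((hb.matrix_conjTranspose.matrix_mul hai).matrix_mul hb).add ha)

/-! ## The Gram data: continuity, measurability, bounds -/

section GramData

variable {S : ℕ} {m : ℝ}
variable (A : GaugeConfig 4 (2 * S + 1) (Matrix.specialUnitaryGroup (Fin N) ℂ) → Fin (2 * S + 1) →
    Matrix (((Fin 3 → ZMod (2 * S + 1)) × Fin N) × Fin 2) (((Fin 3 → ZMod (2 * S + 1)) × Fin N) × Fin 2) ℂ)
  (hA : ∀ V t, A V t = sliceDiag (unitaryFundamentalRep (Fin N) ℂ) (apLift V) m t)
  (Ys W : GaugeConfig 4 (2 * S + 1) (Matrix.specialUnitaryGroup (Fin N) ℂ) → Fin (2 * S + 1) →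
    Matrix ((((Fin 3 → ZMod (2 * S + 1)) × Fin N) × Fin 2) ⊕ (((Fin 3 → ZMod (2 * S + 1)) × Fin N) × Fin 2))
      ((((Fin 3 → ZMod (2 * S + 1)) × Fin N) × Fin 2) ⊕ (((Fin 3 → ZMod (2 * S + 1)) × Fin N) × Fin 2)) ℂ)
  (hYs : ∀ V t, Ys V t = transferStep (A V t) (sliceOff (unitaryFundamentalRep (Fin N) ℂ) (apLift V) t) (A V t))
  (hW : ∀ V t, W V t = linkBlock (sliceLink (unitaryFundamentalRep (Fin N) ℂ) (unitaryLift V) t))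
  (G : GaugeConfig 4 (2 * S + 1) (Matrix.specialUnitaryGroup (Fin N) ℂ) →
    Matrix ((((Fin 3 → ZMod (2 * S + 1)) × Fin N) × Fin 2) ⊕ (((Fin 3 → ZMod (2 * S + 1)) × Fin N) × Fin 2))
      ((((Fin 3 → ZMod (2 * S + 1)) × Fin N) × Fin 2) ⊕ (((Fin 3 → ZMod (2 * S + 1)) × Fin N) × Fin 2)) ℂ)
  (hG : ∀ V, G V = (List.ofFn fun s : Fin (S + 1) =>
    (W V (Fin.castLE (by omega) s))ᴴ * (if (s : ℕ) = 0 then 1 else Ys V (Fin.castLE (by omega) s))).reverse.prod)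
  (c : GaugeConfig 4 (2 * S + 1) (Matrix.specialUnitaryGroup (Fin N) ℂ) → ℂ)
  (hc : ∀ V, c V = ∏ s : Fin S, (A V (Fin.castLE (by omega) s.succ)).det)

include hA in
omit [NeZero N] in
/-- `V ↦ a_t[V]` is continuous. -/
theorem continuous_gramA (t : Fin (2 * S + 1)) : Continuous fun V => A V t := by
  rw [show (fun V => A V t) = fun V => sliceDiag (unitaryFundamentalRep (Fin N) ℂ) (apLift V) m t from
    funext fun V => hA V t]
  exact continuous_sliceDiag_apLift m t

include hA hYs in
/-- `V ↦ 𝒴_t[V]` is continuous (`m > -1`). -/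
theorem continuous_gramYs (hm : -1 < m) (t : Fin (2 * S + 1)) : Continuous fun V => Ys V t := by
  rw [show (fun V => Ys V t) = fun V => transferStep (sliceDiag (unitaryFundamentalRep (Fin N) ℂ) (apLift V) m t)
      (sliceOff (unitaryFundamentalRep (Fin N) ℂ) (apLift V) t) (sliceDiag (unitaryFundamentalRep (Fin N) ℂ) (apLift V) m t)
    from funext fun V => by rw [hYs, hA]]
  exact continuous_transferStep_slice hm t

include hW in
omit [NeZero N] in
/-- `V ↦ Ŵ_t[V]` is continuous. -/
theorem continuous_gramW (t : Fin (2 * S + 1)) : Continuous fun V => W V t := by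
  rw [show (fun V => W V t) = fun V => linkBlock (sliceLink (unitaryFundamentalRep (Fin N) ℂ) (unitaryLift V) t)
    from funext fun V => hW V t]
  unfold linkBlock
  exact Continuous.matrix_fromBlocks (continuous_sliceLink_unitaryLift t) continuous_const continuous_const
    (continuous_sliceLink_unitaryLift t)

include hA hYs hW hG in
/-- `V ↦ 𝔊[V]` is continuous (`m > -1`). -/
theorem continuous_gramG (hm : -1 < m) : Continuous G := by
  rw [funext hG]
  simp only [List.ofFn_eq_map, ← List.map_reverse]
  refine continuous_list_prod _ fun s _ => ?_
  exact (continuous_gramW W hW _).matrix_conjTranspose.matrix_mul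
    (continuous_ite_const' _ continuous_const (continuous_gramYs A hA Ys hYs hm _))

include hA hYs hW hG in
/-- The stacked matrix `[1; 𝔊[V]]` depends continuously on `V`. -/
theorem continuous_fromRows_gramG (hm : -1 < m) :
    Continuous fun V => Matrix.fromRows
      (1 : Matrix ((((Fin 3 → ZMod (2 * S + 1)) × Fin N) × Fin 2) ⊕ (((Fin 3 → ZMod (2 * S + 1)) × Fin N) × Fin 2))
        ((((Fin 3 → ZMod (2 * S + 1)) × Fin N) × Fin 2) ⊕ (((Fin 3 → ZMod (2 * S + 1)) × Fin N) × Fin 2)) ℂ) (G V) := by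
  refine continuous_matrix fun p q => ?_
  rcases p with p | p
  · simp only [Matrix.fromRows_apply_inl]
    exact continuous_const
  · simp only [Matrix.fromRows_apply_inr]
    exact (continuous_gramG A hA Ys W hYs hW G hG hm).matrix_elem p q

include hA hc in
omit [NeZero N] in
/-- `V ↦ c(V)` is continuous. -/
theorem continuous_gramc : Continuous c := by
  rw [funext hc]
  exact continuous_finsetProd _ fun s _ => (continuous_gramA A hA _).matrix_det

include hA hYs hW hG hc in
/-- **The fermionic feature `Φ_q(V) = c(V) · Ψ_q(𝔊(V))` depends continuously on the gauge field**
(`m > -1`). -/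
theorem continuous_gramFeature' (hm : -1 < m)
    (q : _) :
    Continuous fun V => c V * gramFeature (G V) q := by
  unfold gramFeature
  exact (continuous_gramc A hA c hc).mul ((continuous_fromRows_gramG A hA Ys W hYs hW G hG hm).matrix_submatrix q id).matrix_det

include hA hYs in
/-- **The kernel `K_{q' q}(V) = det a_{S+1}[V] · gramCoupling 1 𝒴_{S+1}[V] q' q` depends
continuously on the gauge field** (`m > -1`). -/
theorem continuous_gramCoupling' (hS : 1 ≤ S) (hm : -1 < m)
    (q' q : _) :
    Continuous fun V => (A V ⟨S + 1, by omega⟩).det * gramCoupling 1 (Ys V ⟨S + 1, by omega⟩) q' q := by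
  refine (continuous_gramA A hA _).matrix_det.mul ?_
  simp only [gramCoupling, Matrix.of_apply]
  refine continuous_const.mul ?_
  exact ((Continuous.matrix_fromBlocks continuous_const continuous_const continuous_const
    (continuous_gramYs A hA Ys hYs hm _)).matrix_submatrix q q').matrix_det

include hA hYs hW hG hc in
/-- The fermionic feature is measurable. -/
theorem measurable_gramFeature' (hm : -1 < m)
    (q : _) :
    Measurable fun V => c V * gramFeature (G V) q := by
  haveI := opensMeasurableSpace_gaugeConfig' (L := 2 * S + 1) (N := N)
  exact (continuous_gramFeature' A hA Ys W hYs hW G hG c hc hm q).measurable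

include hA hYs in
/-- The kernel is measurable. -/
theorem measurable_gramCoupling' (hS : 1 ≤ S) (hm : -1 < m)
    (q' q : _) :
    Measurable fun V => (A V ⟨S + 1, by omega⟩).det * gramCoupling 1 (Ys V ⟨S + 1, by omega⟩) q' q := by
  haveI := opensMeasurableSpace_gaugeConfig' (L := 2 * S + 1) (N := N)
  exact (continuous_gramCoupling' A hA Ys hYs hS hm q' q).measurable

include hA hYs hW hG hc in
/-- The fermionic features are bounded, uniformly in the index (compactness). -/
theorem exists_bound_gramFeature' (hm : -1 < m) :
    ∃ C : ℝ, ∀ q V, ‖c V * gramFeature (G V) q‖ ≤ C := by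
  -- adapted from `Literature.MathematicalPhysics.QuantumLattice.exists_bound_fermionFeature`
  have hq : ∀ q, ∃ C : ℝ, ∀ V, ‖c V * gramFeature (G V) q‖ ≤ C := fun q => by
      obtain ⟨C, hC⟩ := isCompact_univ.exists_bound_of_continuousOn
        (continuous_gramFeature' A hA Ys W hYs hW G hG c hc hm q).continuousOn
      exact ⟨C, fun U => hC U (Set.mem_univ U)⟩
  choose C hC using hq
  exact ⟨∑ q, |C q|, fun q U => (hC q U).trans ((le_abs_self _).trans
    (Finset.single_le_sum (fun q _ => abs_nonneg (C q)) (Finset.mem_univ q)))⟩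

include hA hYs in
/-- The kernel is bounded, uniformly in the indices. -/
theorem exists_bound_gramCoupling' (hS : 1 ≤ S) (hm : -1 < m) :
    ∃ C : ℝ, ∀ q' q V, ‖(A V ⟨S + 1, by omega⟩).det * gramCoupling 1 (Ys V ⟨S + 1, by omega⟩) q' q‖ ≤ C := by
  -- adapted from `Literature.MathematicalPhysics.QuantumLattice.exists_bound_fermionCoupling`
  have hq : ∀ q' q, ∃ C : ℝ, ∀ V, ‖(A V ⟨S + 1, by omega⟩).det * gramCoupling 1 (Ys V ⟨S + 1, by omega⟩) q' q‖ ≤ C :=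
    fun q' q => by
      obtain ⟨C, hC⟩ := isCompact_univ.exists_bound_of_continuousOn
        (continuous_gramCoupling' A hA Ys hYs hS hm q' q).continuousOn
      exact ⟨C, fun U => hC U (Set.mem_univ U)⟩
  choose C hC using hq
  refine ⟨∑ q', ∑ q, |C q' q|, fun q' q U => (hC q' q U).trans ((le_abs_self _).trans ?_)⟩
  exact (Finset.single_le_sum (fun q _ => abs_nonneg (C q' q)) (Finset.mem_univ q)).trans
    (Finset.single_le_sum (fun q' _ => Finset.sum_nonneg fun q _ => abs_nonneg (C q' q)) (Finset.mem_univ q'))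

include hA hYs in
/-- **The kernel is positive semidefinite** (`m > -1`: `det a_{S+1} > 0`, `𝒴_{S+1} > 0`). -/
theorem posSemidef_gramCoupling' (hS : 1 ≤ S) (hm : -1 < m) (V : GaugeConfig 4 (2 * S + 1) (Matrix.specialUnitaryGroup (Fin N) ℂ)) :
    (Matrix.of fun q' q => (A V ⟨S + 1, by omega⟩).det * gramCoupling 1 (Ys V ⟨S + 1, by omega⟩) q' q).PosSemidef := by
  have heq : (Matrix.of fun q' q => (A V ⟨S + 1, by omega⟩).det * gramCoupling 1 (Ys V ⟨S + 1, by omega⟩) q' q) =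
      (A V ⟨S + 1, by omega⟩).det • gramCoupling 1 (Ys V ⟨S + 1, by omega⟩) := by
    ext q' q; rfl
  rw [heq, hYs, hA]
  have ha := posDef_sliceDiag (unitaryFundamentalRep (Fin N) ℂ) unitaryFundamentalRep_mem_unitaryGroup (apLift V) hm
    (⟨S + 1, by omega⟩ : Fin (2 * S + 1))
  exact (posSemidef_gramCoupling Matrix.PosDef.one (posDef_transferStep ha ha).posSemidef).smul ha.det_pos.le

include hA hYs hW hG hc in
omit [NeZero N] in
/-- **Locality of the fermionic feature**: `Φ_q` depends only on the links based in the slices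
`0 ≤ t ≤ S`, and for `t = 0` only on the temporal ones (the crossing layer) — a subset of
`WilsonOddRP.oPosEdges ∪ WilsonOddRP.lowerEdges`. -/
theorem gramFeature_congr' {U V : GaugeConfig 4 (2 * S + 1) (Matrix.specialUnitaryGroup (Fin N) ℂ)}
    (hUV : ∀ e : Edge 4 (2 * S + 1), (e.1 0).val ≤ S → (e.2 = 0 ∨ 1 ≤ (e.1 0).val) → U e = V e)
    (q : _) :
    c U * gramFeature (G U) q = c V * gramFeature (G V) q := by
  have hsp : ∀ s : Fin (S + 1), (s : ℕ) ≠ 0 → ∀ (y : Fin 3 → ZMod (2 * S + 1)) (j : Fin 3),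
      U (sliceSite (Fin.castLE (by omega) s) y, j.succ) = V (sliceSite (Fin.castLE (by omega) s) y, j.succ) :=
    fun s hs y j => hUV _ (by rw [val_sliceSite_zero', Fin.val_castLE]; omega)
      (Or.inr (by rw [val_sliceSite_zero', Fin.val_castLE]; omega))
  have htm : ∀ (s : Fin (S + 1)) (y : Fin 3 → ZMod (2 * S + 1)),
      U (sliceSite (Fin.castLE (by omega) s) y, 0) = V (sliceSite (Fin.castLE (by omega) s) y, 0) :=
    fun s y => hUV _ (by rw [val_sliceSite_zero', Fin.val_castLE]; omega) (Or.inl rfl)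
  have hcUV : c U = c V := by
    rw [hc, hc]
    refine Finset.prod_congr rfl fun s _ => ?_
    rw [hA, hA, (sliceDiag_sliceOff_congr (hsp s.succ (by simp)) m).1]
  have hGUV : G U = G V := by
    rw [hG, hG]
    congr 2
    refine List.ofFn_inj.2 (funext fun s => ?_)
    rw [hW, hW, sliceLink_congr (htm s)]
    by_cases hs : (s : ℕ) = 0
    · rw [if_pos hs, if_pos hs]
    · rw [if_neg hs, if_neg hs, hYs, hYs, hA, hA, (sliceDiag_sliceOff_congr (hsp s hs) m).1,
        (sliceDiag_sliceOff_congr (hsp s hs) m).2]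
  rw [hcUV, hGUV]

include hA hYs in
omit [NeZero N] in
/-- **Locality of the kernel**: `K` depends only on the spatial links of the shared slice
`t = S + 1` (`WilsonOddRP.oSharedEdges`). -/
theorem gramCoupling_congr' (hS : 1 ≤ S) {U V : GaugeConfig 4 (2 * S + 1) (Matrix.specialUnitaryGroup (Fin N) ℂ)}
    (hUV : ∀ e : Edge 4 (2 * S + 1), e.2 ≠ 0 → (e.1 0).val = S + 1 → U e = V e)
    (q' q : _) :
    (A U ⟨S + 1, by omega⟩).det * gramCoupling 1 (Ys U ⟨S + 1, by omega⟩) q' q =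
      (A V ⟨S + 1, by omega⟩).det * gramCoupling 1 (Ys V ⟨S + 1, by omega⟩) q' q := by
  have hsp : ∀ (y : Fin 3 → ZMod (2 * S + 1)) (j : Fin 3),
      U (sliceSite (⟨S + 1, by omega⟩ : Fin (2 * S + 1)) y, j.succ) = V (sliceSite (⟨S + 1, by omega⟩ : Fin (2 * S + 1)) y, j.succ) :=
    fun y j => hUV _ (Fin.succ_ne_zero j) (by rw [val_sliceSite_zero'])
  rw [hYs, hYs, hA, hA, (sliceDiag_sliceOff_congr hsp m).1, (sliceDiag_sliceOff_congr hsp m).2]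

end GramData

/-- **Registered sub-goal `stubFW_gramRegularity` of `stub_fineWeightAdmissible`** (clause (6),
regularity input of the reflection-positivity mechanism): the transfer step `𝒴_t[U]` of the
antiperiodic Wilson–Dirac operator depends continuously on the `SU(N)` gauge field (`m > -1`). -/
theorem stubFW_gramRegularity : ∀ (n N : ℕ) [NeZero N] (m : ℝ), -1 < m → ∀ t : Fin (n + 1),
    Continuous fun U : GaugeConfig 4 (n + 1) (Matrix.specialUnitaryGroup (Fin N) ℂ) =>
      transferStep (sliceDiag (unitaryFundamentalRep (Fin N) ℂ) (apLift U) m t)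
        (sliceOff (unitaryFundamentalRep (Fin N) ℂ) (apLift U) t)
        (sliceDiag (unitaryFundamentalRep (Fin N) ℂ) (apLift U) m t) :=
  fun _ _ _ _ hm t => continuous_transferStep_slice hm t

end FineWeight

end Summit.QuantumFields.QCD.Cruxes.InterleavedFlowProper.OffsetLastFormatHandover

end
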